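import Summits.ABC.IUTFork.Conditional.AbcOfSGenuineKWildInhabitedRow283
import Summits.ABC.IUTFork.Cor312LicenceWildInhabitedTripleBad
import Summits.ABC.IUTFork.Cor312GenuineKLocalType
import Summits.ABC.IUTFork.Cor312GenuineKWildLowerBound
import HarnessLib

/-!
# Branch C / R-W W1, inhabited side — OPEN-10.md row 8 (`283 + 5¹¹·13² = 2⁸·3⁸·17³`, `l = 283`) with the TAME local types DISCHARGED:
# S_H inhabited modulo the 3-adic and 5-adic ramification indices only

PROOF-ONLY file (no `def`, no new `Prop`, no instance) of the abc-iut cell — D-0079 RESCUE sub-cell R-W «WINDOW Θ-SIDE INEQUALITY», W1 ROW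
DECISIONS (D-0107), seat abc-iut-W-row-2 gen 0; sequel of `AbcOfSGenuineKWildInhabitedRow283` (p476394). TAKES NO SIDE on [IUTchIII] Cor. 3.12
or on any author; «inhabited as typed» ≠ «asserted in print».

WHAT IS PROVED (namespace `Summit.ABC.IUTFork.Conditional`). **`GenuineK.exists_qPinned_and_hull_chosen_triple_283_of_localType_three_five`** —
for EVERY genuine Θ-volume datum `T` at `(ratPoint (283/8251953408), 283)`, the CHOSEN realising ideles and every choice of the free context
binders / columns: IF every bad fibre point over `3` has `e(K_x/ℚ_3) = 8490 = 30·l` (`he3`) and every bad fibre point over `5` has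
`e(K_x/ℚ_5) = 16980 = 60·l` (`he5`) — the tree proves `30·l ∣ e` resp. `60·l ∣ e` there (abc-iut-W-neg-2 `Cor312GenuineKCyclotomicLowerBound`), the
converse bound is GAP G-Wnum2-1 — THEN branch C's per-datum antecedent «∃ ρ qK, QPinned ∧ PilotKummerCompatHull» holds at
`settingPrVolSharp (pilotDataOfK T.D T.K) …`. The TAME bad primes `13`, `17` carry NO hypothesis any more: their index `e` is READ OFF the datum
(constant on the fibre, `WRow.absRamificationIdx_kOf_eq_of_finrank_eq_one`), pinned by the tree to `e ∣ 60·l` (abc-iut-W-neg-1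
`GenuineK.absRamificationIdx_kOf_dvd_ratPoint`), `l ∣ e` and `15·l ∣ e·t` (abc-iut-W-neg-2 `Cor312GenuineKWildLowerBound`, `t = v_p(abc) = 2, 3`),
i.e. `e₁₃ ∈ {15, 30, 60}·283`, `e₁₇ ∈ {5, 10, 15, 20, 30, 60}·283`, and the integer cells hold at EACH of these nine values (`decide`; minimal
margins `25351 / 55096 / 114586` at `13`, `6512 … 109214` at `17`). Bridge: this seat's `Cor312LicenceWildInhabitedTripleBad` (v2: arithmetic
demanded only at primes carrying a bad fibre point) over abc-iut-W-row-1's socket p470548.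

HONEST SCOPE: OUR sharp containers and Dupuy–Hilado's typed (Ind1)/(Ind2); STRONGER-THAN-PRINT hull licence; NON-EMPTINESS of the datum type,
admissibility and Szpiro-badness NOT claimed; `he3`/`he5` are HYPOTHESES; nothing about the printed GLOBAL inequality or the number-level corollary;
typed ≠ proved; instantiated ≠ endorsed. [cite: Mochizuki2012, IUTchI Def. 3.1 (b),(c) pp. 61–62, Rmk. 3.1.5 p. 65; IUTchIII Cor. 3.12 Step (xi-d)
p. 183, (xi-f) p. 184; IUTchIV Thm. 1.10 p. 22, Cor. 2.2 (ii) proof p. 44–46] [cite: DupuyHilado2025, §3.3, §3.4, §4.9, §4.12]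
[cite: SilvermanATAEC1994, V.5 Thm. 5.3] [claim: Mochizuki2012, status: disputed] for every IUT sentence quoted.
-/

noncomputable section

open Set Function NumberField IsDedekindDomain

namespace Summit.ABC.IUTFork.Conditional

open Thm311 Thm311.Real Cor312 Cor312Vol Cor312Prov Literature.IUT.LogThetaLattice Literature.IUT.LogVolume
  Literature.IUT.HodgeTheaters Literature.IUT.LogVolume.Cor22
open Literature.NumberTheory.NumberFields Literature.NumberTheory.GaloisRepresentations.Ultrametric
open Literature.NumberTheory.DiophantineGeometry Literature.NumberTheory.DiophantineGeometry.GenEll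

/-- The tame index set over `13`: `e = 283·d`, `d ∣ 60`, `15 ∣ 2d` ⇒ `d ∈ {15, 30, 60}`. [folklore] -/
theorem eq_of_dvd_sixty_of_fifteen_dvd_mul_two {d : ℕ} (hd : d ∣ 60) (h15 : 15 ∣ d * 2) : d = 15 ∨ d = 30 ∨ d = 60 := by
  have hle := Nat.le_of_dvd (by norm_num) hd
  interval_cases d <;> omega

/-- The tame index set over `17`: `e = 283·d`, `d ∣ 60`, `15 ∣ 3d` ⇒ `d ∈ {5, 10, 15, 20, 30, 60}`. [folklore] -/
theorem eq_of_dvd_sixty_of_fifteen_dvd_mul_three {d : ℕ} (hd : d ∣ 60) (h15 : 15 ∣ d * 3) :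
    d = 5 ∨ d = 10 ∨ d = 15 ∨ d = 20 ∨ d = 30 ∨ d = 60 := by
  have hle := Nat.le_of_dvd (by norm_num) hd
  interval_cases d <;> omega

set_option maxRecDepth 16384 in
/-- **OPEN-10 ROW 8 — S_H INHABITED at `283 + 5¹¹·13² = 2⁸·3⁸·17³`, `l = 283`, modulo the 3-adic and 5-adic ramification indices only.**
For every genuine Θ-volume datum `T` at `(ratPoint (283/8251953408), 283)`, the CHOSEN realising ideles, every choice of the free context binders and
columns: IF every bad fibre point over `3` has `e(K_x/ℚ_3) = 8490` (`he3`) and every bad fibre point over `5` has `e(K_x/ℚ_5) = 16980` (`he5`), THEN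
«∃ ρ qK, QPinned ∧ PilotKummerCompatHull» at `settingPrVolSharp (pilotDataOfK T.D T.K) …`. The indices over the tame bad primes `13, 17` are read
off the datum and pinned by the tree to `{15,30,60}·283` resp. `{5,…,60}·283`; all nine tame cases × `141` labels are decided.
[cite: Mochizuki2012, IUTchIII Cor. 3.12 Step (xi-d) p. 183, (xi-f) p. 184; IUTchIV Cor. 2.2 (ii) proof p. 44–46] [cite: DupuyHilado2025, §3.3, §3.4, §4.9]
[claim: Mochizuki2012, status: disputed] -/
theorem GenuineK.exists_qPinned_and_hull_chosen_triple_283_of_localType_three_five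
    (T : Cor22.ThetaVolumeDatumAt (ratPoint (((283 : ℕ) : ℚ) / (8251953408 : ℕ))) 283)
    (he3 : letI := T.instFieldF; letI := T.instNumberFieldF; letI := T.instAlgebraF; letI := T.instFieldK
      letI := T.instNumberFieldK; letI := T.instAlgebraK; letI := T.instFieldFbar; letI := T.instAlgebraFbar
      letI := T.instAlgebraKFbar; letI := T.instIsElliptic
      ∀ (pp : Nat.Primes) (x : (thetaIndex (pilotDataOfK T.D T.K)).Fibre (.inr pp)), haveI : Fact (pp : ℕ).Prime := ⟨pp.2⟩
        (pp : ℕ) = 3 → placeOf (pilotDataOfK T.D T.K) pp.1 x ∈ (pilotDataOfK T.D T.K).S →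
          absRamificationIdx (pp : ℕ) (kOf (pilotDataOfK T.D T.K) pp.1 x) = 8490)
    (he5 : letI := T.instFieldF; letI := T.instNumberFieldF; letI := T.instAlgebraF; letI := T.instFieldK
      letI := T.instNumberFieldK; letI := T.instAlgebraK; letI := T.instFieldFbar; letI := T.instAlgebraFbar
      letI := T.instAlgebraKFbar; letI := T.instIsElliptic
      ∀ (pp : Nat.Primes) (x : (thetaIndex (pilotDataOfK T.D T.K)).Fibre (.inr pp)), haveI : Fact (pp : ℕ).Prime := ⟨pp.2⟩
        (pp : ℕ) = 5 → placeOf (pilotDataOfK T.D T.K) pp.1 x ∈ (pilotDataOfK T.D T.K).S →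
          absRamificationIdx (pp : ℕ) (kOf (pilotDataOfK T.D T.K) pp.1 x) = 16980) :
    letI := T.instFieldF; letI := T.instNumberFieldF; letI := T.instAlgebraF; letI := T.instFieldK
    letI := T.instNumberFieldK; letI := T.instAlgebraK; letI := T.instFieldFbar; letI := T.instAlgebraFbar
    letI := T.instAlgebraKFbar; letI := T.instIsElliptic
    ∀ (M : Type) [Field M] [NumberField M]
      (archPk : ∀ (j : (thetaIndex (pilotDataOfK T.D T.K)).Label) (vQ : (thetaIndex (pilotDataOfK T.D T.K)).VQ),
        Set ((logShellsDH (pilotDataOfK T.D T.K) (analyticLogv T.K)).Packet j vQ))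
      (archSub : ∀ (j : (thetaIndex (pilotDataOfK T.D T.K)).Label) (v : (thetaIndex (pilotDataOfK T.D T.K)).V),
        Set ((logShellsDH (pilotDataOfK T.D T.K) (analyticLogv T.K)).Packet j ((thetaIndex (pilotDataOfK T.D T.K)).over v)))
      (Ψ : ℤ → ∀ v : (thetaIndex (pilotDataOfK T.D T.K)).V, v ∈ (thetaIndex (pilotDataOfK T.D T.K)).Vbad →
        Set ((logShellsDH (pilotDataOfK T.D T.K) (analyticLogv T.K)).StarPacket v))
      (act : ℤ → ∀ v : (thetaIndex (pilotDataOfK T.D T.K)).V, v ∈ (thetaIndex (pilotDataOfK T.D T.K)).Vbad →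
        (logShellsDH (pilotDataOfK T.D T.K) (analyticLogv T.K)).StarPacket v →
          Module.End ℚ ((logShellsDH (pilotDataOfK T.D T.K) (analyticLogv T.K)).StarPacket v))
      (Mmod : ℤ → ∀ j : (thetaIndex (pilotDataOfK T.D T.K)).LabelStar,
        Set ((logShellsDH (pilotDataOfK T.D T.K) (analyticLogv T.K)).GlobalPacket j.1))
      (region : ℤ → ∀ j : (thetaIndex (pilotDataOfK T.D T.K)).LabelStar, FinDivisor M → ∀ vQ : (thetaIndex (pilotDataOfK T.D T.K)).VQ,
        Set ((logShellsDH (pilotDataOfK T.D T.K) (analyticLogv T.K)).Packet j.1 vQ))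
      (n : ℤ) {HT : Type} {LogLink : HT → HT → Type} {IsFull : ∀ {s t : HT}, LogLink s t → Prop}
      (lat : LGPGaussianLogThetaLattice LogLink IsFull)
      {Frd : Type} {IsoF : Frd → Frd → Type} {Ob : Frd → Type} {realify : Frd → Frd} {Strip : Type}
      {IsoS : Strip → Strip → Type} {Mv : ∀ v : (thetaIndex (pilotDataOfK T.D T.K)).V, v ∈ (thetaIndex (pilotDataOfK T.D T.K)).Vbad → Type}
      [∀ v h, Monoid (Mv v h)]
      (sig : GlobalLGPFrobenioidSignature (thetaIndex (pilotDataOfK T.D T.K)).lstar (thetaIndex (pilotDataOfK T.D T.K)).V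
        (· ∈ (thetaIndex (pilotDataOfK T.D T.K)).Vbad) Frd IsoF Ob realify Strip IsoS Mv)
      (split : SplittingMonoids Mv) {ObΔ : Type}
      {N : ∀ v : (thetaIndex (pilotDataOfK T.D T.K)).V, v ∈ (thetaIndex (pilotDataOfK T.D T.K)).Vbad → Type}
      [∀ v h, Monoid (N v h)] (qData : QPilotData ObΔ N)
      (col : ℤ → Column (logShellsDH (pilotDataOfK T.D T.K) (analyticLogv T.K))),
      ∃ (ρ' : (∀ v : (thetaIndex (pilotDataOfK T.D T.K)).V, v ∈ (thetaIndex (pilotDataOfK T.D T.K)).Vbad →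
            Set ((logShellsDH (pilotDataOfK T.D T.K) (analyticLogv T.K)).StarPacket v)) →
          ∀ (j : (thetaIndex (pilotDataOfK T.D T.K)).Label) (vQ : (thetaIndex (pilotDataOfK T.D T.K)).VQ),
            Set ((logShellsDH (pilotDataOfK T.D T.K) (analyticLogv T.K)).Packet j vQ))
        (qK : ∀ v : (thetaIndex (pilotDataOfK T.D T.K)).V, v ∈ (thetaIndex (pilotDataOfK T.D T.K)).Vbad →
          Set ((logShellsDH (pilotDataOfK T.D T.K) (analyticLogv T.K)).StarPacket v)),
        QPinned ({ toSituation := (situationPrVol (pilotDataOfK T.D T.K) (logvAnalytic_analyticLogv (F := T.K)) M archPk archSub Ψ act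
              Mmod region), col := col } : LatticeSituation (thetaIndex (pilotDataOfK T.D T.K)))
          (settingPrVolSharp (pilotDataOfK T.D T.K) (logvAnalytic_analyticLogv (F := T.K)) M archPk archSub Ψ act Mmod region n lat
            sig split qData (exists_realising_qIdeles_pilotDataOfK T.D).choose (exists_realising_thetaIdeles_pilotDataOfK T.D).choose
            (exists_realising_qIdeles_pilotDataOfK T.D).choose_spec.1 (exists_realising_qIdeles_pilotDataOfK T.D).choose_spec.2.1) ρ' qK ∧
        PilotKummerCompatHull ({ toSituation := (situationPrVol (pilotDataOfK T.D T.K) (logvAnalytic_analyticLogv (F := T.K)) M archPk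
              archSub Ψ act Mmod region), col := col } : LatticeSituation (thetaIndex (pilotDataOfK T.D T.K)))
          (settingPrVolSharp (pilotDataOfK T.D T.K) (logvAnalytic_analyticLogv (F := T.K)) M archPk archSub Ψ act Mmod region n lat
            sig split qData (exists_realising_qIdeles_pilotDataOfK T.D).choose (exists_realising_thetaIdeles_pilotDataOfK T.D).choose
            (exists_realising_qIdeles_pilotDataOfK T.D).choose_spec.1 (exists_realising_qIdeles_pilotDataOfK T.D).choose_spec.2.1) ρ' qK := by
  classical
  letI := T.instFieldF; letI := T.instNumberFieldF; letI := T.instAlgebraF; letI := T.instFieldK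
  letI := T.instNumberFieldK; letI := T.instAlgebraK; letI := T.instFieldFbar; letI := T.instAlgebraFbar
  letI := T.instAlgebraKFbar; letI := T.instIsElliptic
  intro M _ _ archPk archSub Ψ act Mmod region n HT LogLink IsFull lat Frd IsoF Ob realify Strip IsoS Mv _ sig split ObΔ N _ qData col
  have hF : Module.finrank ℚ (fieldOfModuli T.E) = 1 :=
    T.finrank_rat_fieldOfModuli_eq_dmod.trans (dmod_eq_one_of_degree_le_one (by rw [degree_ratPoint]))
  have hj : T.E.j = ((Cor22.jInv (((283 : ℕ) : ℚ) / (8251953408 : ℕ)) : ℚ) : T.F) := by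
    rw [T.j_eq]; exact eq_ratCast _ _
  have hl : (pilotDataOfK T.D T.K).lstar = 141 := by simp only [PilotData.lstar, pilotDataOfK_l]
  obtain ⟨hf3, hf5, hf13, hf17⟩ := factorization_triple_283
  -- the per-prime index: BY NAME over `3, 5`, READ OFF THE DATUM elsewhere
  set eT : Nat.Primes → ℕ := fun pp =>
    haveI : Fact (pp : ℕ).Prime := ⟨pp.2⟩
    if (pp : ℕ) = 3 then 8490 else if (pp : ℕ) = 5 then 16980 else
      if h : ∃ x : (thetaIndex (pilotDataOfK T.D T.K)).Fibre (.inr pp), placeOf (pilotDataOfK T.D T.K) pp.1 x ∈ (pilotDataOfK T.D T.K).S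
      then absRamificationIdx (pp : ℕ) (kOf (pilotDataOfK T.D T.K) pp.1 h.choose) else 1 with heT
  -- the pole orders at the tame bad primes
  have hpole : ∀ (pp : Nat.Primes), (pp : ℕ) ∣ 283 * 8251953125 * 8251953408 → (pp : ℕ) ≠ 2 →
      ∀ v : HeightOneSpectrum (𝓞 ℚ), Rat.HeightOneSpectrum.natGenerator v = pp →
        ord ℚ v (Cor22.jInv (((283 : ℕ) : ℚ) / (8251953408 : ℕ))) =
          -(2 * (((283 * 8251953125 * 8251953408).factorization pp : ℕ) : ℤ)) := fun pp hdvd h2 v hv =>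
    (Cor22.ord_jInv_ratPoint_triple_eq isABCTriple_frey283 v (by rw [hv]; exact h2) (by rw [hv]; exact hdvd)).trans (by rw [hv])
  refine exists_qPinned_and_hull_settingPrVolSharp_pilotDataOfK_triple_of_bad T.D (logvAnalytic_analyticLogv (F := T.K)) M archPk
    archSub Ψ act Mmod region n lat sig split qData (exists_realising_qIdeles_pilotDataOfK T.D).choose
    (exists_realising_thetaIdeles_pilotDataOfK T.D).choose (exists_realising_qIdeles_pilotDataOfK T.D).choose_spec.1
    (exists_realising_qIdeles_pilotDataOfK T.D).choose_spec.2.1 col (exists_realising_thetaIdeles_pilotDataOfK T.D).choose_spec.1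
    (exists_realising_thetaIdeles_pilotDataOfK T.D).choose_spec.2.2 (exists_realising_qIdeles_pilotDataOfK T.D).choose_spec.2.2
    isABCTriple_frey283 hj hF eT (fun pp => eT pp - 1)
    (fun pp => if (pp : ℕ) = 3 then 8 else if (pp : ℕ) = 5 then 6 else if (pp : ℕ) = 13 then 3 else if eT pp ≤ 4624 then 2 else 3)
    (fun pp x hx => ?_) (fun pp hdvd h2 hl' hbad => ?_)
  · -- the local inputs: `e = eT p` at every bad fibre point (by name over `3, 5`; by fibre-constancy elsewhere), `D = e − 1`
    haveI : Fact (pp : ℕ).Prime := ⟨pp.2⟩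
    have he : absRamificationIdx (pp : ℕ) (kOf (pilotDataOfK T.D T.K) pp.1 x) = eT pp := by
      by_cases h3 : (pp : ℕ) = 3
      · have hv : eT pp = 8490 := by simp only [heT, h3, if_true]
        rw [hv]; exact he3 pp x h3 hx
      · by_cases h5 : (pp : ℕ) = 5
        · have hv : eT pp = 16980 := by simp only [heT, h5, Nat.reduceEqDiff, if_true, if_false]
          rw [hv]; exact he5 pp x h5 hx
        · have hex : ∃ y : (thetaIndex (pilotDataOfK T.D T.K)).Fibre (.inr pp),
              placeOf (pilotDataOfK T.D T.K) pp.1 y ∈ (pilotDataOfK T.D T.K).S := ⟨x, hx⟩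
          have hv : eT pp = absRamificationIdx (pp : ℕ) (kOf (pilotDataOfK T.D T.K) pp.1 hex.choose) := by
            simp only [heT, h3, h5, if_false, dif_pos hex]
          rw [hv]
          exact WRow.absRamificationIdx_kOf_eq_of_finrank_eq_one T.D hF pp x hex.choose
    exact ⟨he, pred_div_le_differentOrd_of_eq (pp : ℕ) he⟩
  · -- the arithmetic at the four bad primes; over `13, 17` for every index the tree allows
    haveI : Fact (pp : ℕ).Prime := ⟨pp.2⟩
    rw [hl]
    rcases eq_of_prime_dvd_triple_283 pp.2 hdvd with h | h | h | h | h | h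
    · exact absurd h h2
    · have hv : eT pp = 8490 := by simp only [heT, h, if_true]
      simp only [hv, h, hf3, if_true, Nat.reduceEqDiff]; decide
    · have hv : eT pp = 16980 := by simp only [heT, h, Nat.reduceEqDiff, if_true, if_false]
      simp only [hv, h, hf5, if_true, if_false, Nat.reduceEqDiff]; decide
    · -- `p = 13`: `e ∣ 60·l`, `l ∣ e`, `15·l ∣ 2e` ⇒ `e ∈ {4245, 8490, 16980}`
      have hv : eT pp = absRamificationIdx (pp : ℕ) (kOf (pilotDataOfK T.D T.K) pp.1 hbad.choose) := by
        simp only [heT, h, Nat.reduceEqDiff, if_false, dif_pos hbad]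
      have hneg : ∀ v : HeightOneSpectrum (𝓞 ℚ), Rat.HeightOneSpectrum.natGenerator v = pp →
          ord ℚ v (Cor22.jInv (((283 : ℕ) : ℚ) / (8251953408 : ℕ))) < 0 := fun v hv => by
        rw [hpole pp hdvd h2 v hv, h, hf13]; norm_num
      have ht : ∀ v : HeightOneSpectrum (𝓞 ℚ), Rat.HeightOneSpectrum.natGenerator v = pp →
          ord ℚ v (Cor22.jInv (((283 : ℕ) : ℚ) / (8251953408 : ℕ))) = -(2 * ((2 : ℕ) : ℤ)) := fun v hv => by
        rw [hpole pp hdvd h2 v hv, h, hf13]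
      obtain ⟨hU, -⟩ := GenuineK.absRamificationIdx_kOf_dvd_ratPoint T pp h2 (by rw [h]; norm_num) (by rw [h]; norm_num) hl' hneg hbad.choose
      have hL1 := GenuineK.prime_dvd_absRamificationIdx_kOf_ratPoint T pp h2 hl' hneg hbad.choose
      have hL2 := GenuineK.fifteen_mul_prime_dvd_absRamificationIdx_kOf_mul_ratPoint T pp h2 hl' (t := 2) (by norm_num) ht hbad.choose
      rw [← hv] at hU hL1 hL2
      obtain ⟨d, hd⟩ := hL1
      have hd60 : d ∣ 60 := Nat.dvd_of_mul_dvd_mul_left (by norm_num : 0 < 283) (by rw [← hd]; simpa [mul_comm] using hU)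
      have hd15 : 15 ∣ d * 2 := Nat.dvd_of_mul_dvd_mul_left (by norm_num : 0 < 283)
        (by have := hL2; rw [hd] at this; simpa [mul_comm, mul_assoc, mul_left_comm] using this)
      rcases eq_of_dvd_sixty_of_fifteen_dvd_mul_two hd60 hd15 with rfl | rfl | rfl <;>
        simp only [hd, h, hf13, if_true, if_false, Nat.reduceEqDiff] <;> decide
    · -- `p = 17`: `e ∣ 60·l`, `l ∣ e`, `15·l ∣ 3e` ⇒ `e ∈ {1415, 2830, 4245, 5660, 8490, 16980}`
      have hv : eT pp = absRamificationIdx (pp : ℕ) (kOf (pilotDataOfK T.D T.K) pp.1 hbad.choose) := by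
        simp only [heT, h, Nat.reduceEqDiff, if_false, dif_pos hbad]
      have hneg : ∀ v : HeightOneSpectrum (𝓞 ℚ), Rat.HeightOneSpectrum.natGenerator v = pp →
          ord ℚ v (Cor22.jInv (((283 : ℕ) : ℚ) / (8251953408 : ℕ))) < 0 := fun v hv => by
        rw [hpole pp hdvd h2 v hv, h, hf17]; norm_num
      have ht : ∀ v : HeightOneSpectrum (𝓞 ℚ), Rat.HeightOneSpectrum.natGenerator v = pp →
          ord ℚ v (Cor22.jInv (((283 : ℕ) : ℚ) / (8251953408 : ℕ))) = -(2 * ((3 : ℕ) : ℤ)) := fun v hv => by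
        rw [hpole pp hdvd h2 v hv, h, hf17]
      obtain ⟨hU, -⟩ := GenuineK.absRamificationIdx_kOf_dvd_ratPoint T pp h2 (by rw [h]; norm_num) (by rw [h]; norm_num) hl' hneg hbad.choose
      have hL1 := GenuineK.prime_dvd_absRamificationIdx_kOf_ratPoint T pp h2 hl' hneg hbad.choose
      have hL2 := GenuineK.fifteen_mul_prime_dvd_absRamificationIdx_kOf_mul_ratPoint T pp h2 hl' (t := 3) (by norm_num) ht hbad.choose
      rw [← hv] at hU hL1 hL2
      obtain ⟨d, hd⟩ := hL1
      have hd60 : d ∣ 60 := Nat.dvd_of_mul_dvd_mul_left (by norm_num : 0 < 283) (by rw [← hd]; simpa [mul_comm] using hU)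
      have hd15 : 15 ∣ d * 3 := Nat.dvd_of_mul_dvd_mul_left (by norm_num : 0 < 283)
        (by have := hL2; rw [hd] at this; simpa [mul_comm, mul_assoc, mul_left_comm] using this)
      rcases eq_of_dvd_sixty_of_fifteen_dvd_mul_three hd60 hd15 with rfl | rfl | rfl | rfl | rfl | rfl <;>
        simp only [hd, h, hf17, if_false, Nat.reduceEqDiff] <;> decide
    · exact absurd h hl'

end Summit.ABC.IUTFork.Conditional

end
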